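import Mathlib.Tactic
import Mathlib.Combinatorics.SetFamily.FourFunctions
import HarnessLib
import HarnessLib.Audit.Tags
import Summits.CriticalPhenomena.PercolationContinuityZ3.Theorems.PercNearOneGluingNoHeavyLowerTailSahiAntichainSplitStep

/-!
# Antichains, meets plus joins: Daykin's inequality on the cross rectangle, and the easy half of the `3 + 4` lemma

Support file (seat `prim-masterthm-p1`, gen 37; `--supports stmt-CriticalPhenomena-4575`).  No `sorry`, no new definitions, standard
axioms.  Memo `run/shared/lean/prim/prim-masterthm/FROM-prim-masterthm-p1-g37-LINEAR-REDUCTION.md` §3 (lemma E3).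

SETTING (files `…SahiAntichainSplit*`): at a point `r`, `crossMeets P r` / `crossJoins P r` are the sets of `a ∩ b` / `a ∪ b` with
`a` above and `b` below `r`; `newLabels P r = #(crossMeets \ meets (below)) + #(crossJoins \ joins (above))`.

NEW HERE ([this work], gen 37).
* `card_above_mul_card_below_le`: **Daykin's inequality on the cross rectangle**, `#above · #below ≤ #crossMeets · #crossJoins`
  (Mathlib's `Finset.le_card_infs_mul_card_sups` in the distributive lattice `Finset α`, after identifying the cross meets / joins
  with `above ⊼ below` / `above ⊻ below`).
* `card_crossMeets_add_card_crossJoins_le`: `#crossMeets + #crossJoins ≤ newLabels + #meets (below) + #joins (above)`.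
* Consequences (lemma «E3» of the threshold reduction, the Daykin half): **three members above and a four-member side below with a
  single meet (a sunflower) give `newLabels ≥ 3`** (`three_le_newLabels_of_three_four_meets_le_one`: `#X · #Y ≥ 12` forces
  `#X + #Y ≥ 7`, and at most `1 + 3` cross labels are old); likewise **a four-member side above with a single join (a co-sunflower)
  against three members below** (`three_le_newLabels_of_four_three_joins_le_one`).  The other half of E3 (a four-member CO-sunflower
  below three members, and its dual) is not a counting statement and is left to the next file; exhaustive data (`2^6`): `newLabels ≥ 5`
  there.
HONEST FRAMING: unconditional lemmas; V5 remains OPEN. [this work]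
-/

namespace Summit.CriticalPhenomena.PercolationContinuityZ3.Theorems.SahiColouredDaykin

open Finset
open scoped FinsetFamily

variable {α : Type*} [DecidableEq α]

/-! ### 1. Daykin on the rectangle -/

/-- The cross meets are the pointwise infima `above ⊼ below`. [this work] -/
theorem crossMeets_eq_infs (P : Finset (Finset α)) (r : α) : crossMeets P r = above P r ⊼ below P r := by
  ext Z
  rw [mem_crossMeets_iff, mem_infs]
  constructor
  · rintro ⟨a, ha, b, hb, hra, hrb, rfl⟩
    exact ⟨a, mem_above_iff.2 ⟨ha, hra⟩, b, mem_below_iff.2 ⟨hb, hrb⟩, rfl⟩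
  · rintro ⟨a, ha, b, hb, rfl⟩
    obtain ⟨haP, hra⟩ := mem_above_iff.1 ha
    obtain ⟨hbP, hrb⟩ := mem_below_iff.1 hb
    exact ⟨a, haP, b, hbP, hra, hrb, rfl⟩

/-- The cross joins are the pointwise suprema `above ⊻ below`. [this work] -/
theorem crossJoins_eq_sups (P : Finset (Finset α)) (r : α) : crossJoins P r = above P r ⊻ below P r := by
  ext W
  rw [mem_crossJoins_iff, mem_sups]
  constructor
  · rintro ⟨a, ha, b, hb, hra, hrb, rfl⟩
    exact ⟨a, mem_above_iff.2 ⟨ha, hra⟩, b, mem_below_iff.2 ⟨hb, hrb⟩, rfl⟩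
  · rintro ⟨a, ha, b, hb, rfl⟩
    obtain ⟨haP, hra⟩ := mem_above_iff.1 ha
    obtain ⟨hbP, hrb⟩ := mem_below_iff.1 hb
    exact ⟨a, haP, b, hbP, hra, hrb, rfl⟩

/-- **Daykin's inequality on the cross rectangle**: `#above · #below ≤ #crossMeets · #crossJoins`. [this work] -/
theorem card_above_mul_card_below_le (P : Finset (Finset α)) (r : α) :
    #(above P r) * #(below P r) ≤ #(crossMeets P r) * #(crossJoins P r) := by
  rw [crossMeets_eq_infs, crossJoins_eq_sups]
  exact Finset.le_card_infs_mul_card_sups _ _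

/-- **Old labels absorb at most `#meets (below) + #joins (above)` cross labels**:
`#crossMeets + #crossJoins ≤ newLabels + #meets (below) + #joins (above)`. [this work] -/
theorem card_crossMeets_add_card_crossJoins_le (P : Finset (Finset α)) (r : α) :
    #(crossMeets P r) + #(crossJoins P r) ≤ newLabels P r + #(meets (below P r)) + #(joins (above P r)) := by
  unfold newLabels newMeets newJoins
  have h1 : #(crossMeets P r) ≤ #(crossMeets P r \ meets (below P r)) + #(meets (below P r)) := card_le_card_sdiff_add_card
  have h2 : #(crossJoins P r) ≤ #(crossJoins P r \ joins (above P r)) + #(joins (above P r)) := card_le_card_sdiff_add_card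
  omega

/-- Arithmetic: `x · y ≥ 12` forces `x + y ≥ 7` (naturals). [this work] -/
theorem seven_le_add_of_twelve_le_mul {x y : ℕ} (h : 12 ≤ x * y) : 7 ≤ x + y := by
  by_contra hlt
  have hx : x ≤ 6 := by omega
  have hy : y ≤ 6 := by omega
  interval_cases x <;> interval_cases y <;> omega

/-! ### 2. Label counts of small sides -/

/-- Three members have at most three pairwise joins. [this work] -/
theorem card_joins_le_three_of_card_eq_three {Q : Finset (Finset α)} (h3 : #Q = 3) : #(joins Q) ≤ 3 := by
  obtain ⟨a, b, c, _, _, _, rfl⟩ := card_eq_three.1 h3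
  have hsub : joins {a, b, c} ⊆ {a ∪ b, a ∪ c, b ∪ c} := by
    intro W hW
    obtain ⟨x, hx, y, hy, hxy, rfl⟩ := mem_joins_iff.1 hW
    simp only [mem_insert, mem_singleton] at hx hy ⊢
    rcases hx with rfl | rfl | rfl <;> rcases hy with rfl | rfl | rfl
    all_goals first | exact absurd rfl hxy | simp [union_comm]
  calc #(joins {a, b, c}) ≤ #({a ∪ b, a ∪ c, b ∪ c} : Finset (Finset α)) := card_le_card hsub
    _ ≤ 3 := card_le_three

/-- Three members have at most three pairwise meets. [this work] -/
theorem card_meets_le_three_of_card_eq_three {Q : Finset (Finset α)} (h3 : #Q = 3) : #(meets Q) ≤ 3 := by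
  obtain ⟨a, b, c, _, _, _, rfl⟩ := card_eq_three.1 h3
  have hsub : meets {a, b, c} ⊆ {a ∩ b, a ∩ c, b ∩ c} := by
    intro Z hZ
    obtain ⟨x, hx, y, hy, hxy, rfl⟩ := mem_meets_iff.1 hZ
    simp only [mem_insert, mem_singleton] at hx hy ⊢
    rcases hx with rfl | rfl | rfl <;> rcases hy with rfl | rfl | rfl
    all_goals first | exact absurd rfl hxy | simp [inter_comm]
  calc #(meets {a, b, c}) ≤ #({a ∩ b, a ∩ c, b ∩ c} : Finset (Finset α)) := card_le_card hsub
    _ ≤ 3 := card_le_three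

/-- A sunflower side (all pairwise meets equal) has at most one meet. [this work] -/
theorem card_meets_le_one_of_sunflower {Q : Finset (Finset α)} {K : Finset α}
    (hK : ∀ a ∈ Q, ∀ a' ∈ Q, a ≠ a' → a ∩ a' = K) : #(meets Q) ≤ 1 := by
  apply card_le_one.2
  intro Z hZ Z' hZ'
  obtain ⟨a, ha, b, hb, hab, rfl⟩ := mem_meets_iff.1 hZ
  obtain ⟨a', ha', b', hb', hab', rfl⟩ := mem_meets_iff.1 hZ'
  rw [hK a ha b hb hab, hK a' ha' b' hb' hab']

/-- A co-sunflower side (all pairwise joins equal) has at most one join. [this work] -/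
theorem card_joins_le_one_of_cosunflower {Q : Finset (Finset α)} {U : Finset α}
    (hU : ∀ a ∈ Q, ∀ a' ∈ Q, a ≠ a' → a ∪ a' = U) : #(joins Q) ≤ 1 := by
  apply card_le_one.2
  intro W hW W' hW'
  obtain ⟨a, ha, b, hb, hab, rfl⟩ := mem_joins_iff.1 hW
  obtain ⟨a', ha', b', hb', hab', rfl⟩ := mem_joins_iff.1 hW'
  rw [hU a ha b hb hab, hU a' ha' b' hb' hab']

/-! ### 3. The Daykin half of lemma E3 -/

/-- **Three above, four below with a single meet ⟹ three new labels.**  (`12 ≤ #X · #Y`, so `#X + #Y ≥ 7`, while at most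
`1 + 3` cross labels are old.) [this work] -/
theorem three_le_newLabels_of_three_four_meets_le_one {P : Finset (Finset α)} {r : α}
    (h3 : #(above P r) = 3) (h4 : #(below P r) = 4) (hL : #(meets (below P r)) ≤ 1) : 3 ≤ newLabels P r := by
  have hD := card_above_mul_card_below_le P r
  rw [h3, h4] at hD
  have h7 := seven_le_add_of_twelve_le_mul (by omega)
  have hc := card_crossMeets_add_card_crossJoins_le P r
  have hJ := card_joins_le_three_of_card_eq_three h3
  omega

/-- **Four above with a single join, three below ⟹ three new labels.** [this work] -/
theorem three_le_newLabels_of_four_three_joins_le_one {P : Finset (Finset α)} {r : α}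
    (h4 : #(above P r) = 4) (h3 : #(below P r) = 3) (hJ : #(joins (above P r)) ≤ 1) : 3 ≤ newLabels P r := by
  have hD := card_above_mul_card_below_le P r
  rw [h3, h4] at hD
  have h7 := seven_le_add_of_twelve_le_mul (by omega)
  have hc := card_crossMeets_add_card_crossJoins_le P r
  have hL := card_meets_le_three_of_card_eq_three h3
  omega

/-- E3, Daykin half, in sunflower form: three members above and a four-member SUNFLOWER below give three new labels. [this work] -/
theorem three_le_newLabels_of_three_sunflower_four {P : Finset (Finset α)} {r : α} {K : Finset α}
    (h3 : #(above P r) = 3) (h4 : #(below P r) = 4) (hK : ∀ b ∈ below P r, ∀ b' ∈ below P r, b ≠ b' → b ∩ b' = K) :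
    3 ≤ newLabels P r :=
  three_le_newLabels_of_three_four_meets_le_one h3 h4 (card_meets_le_one_of_sunflower hK)

/-- E3, Daykin half, dual form: a four-member CO-SUNFLOWER above and three members below give three new labels. [this work] -/
theorem three_le_newLabels_of_cosunflower_four_three {P : Finset (Finset α)} {r : α} {U : Finset α}
    (h4 : #(above P r) = 4) (h3 : #(below P r) = 3) (hU : ∀ a ∈ above P r, ∀ a' ∈ above P r, a ≠ a' → a ∪ a' = U) :
    3 ≤ newLabels P r :=
  three_le_newLabels_of_four_three_joins_le_one h4 h3 (card_joins_le_one_of_cosunflower hU)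

/-- A by-product for two-member sides: with two members above (one old join) and a SUNFLOWER of `q ≥ 3` members below (one old meet),
`newLabels ≥ #X + #Y − 2` and `#X · #Y ≥ 2q`; e.g. `q = 3` already gives three new labels (compare `…SplitTwoThree`). [this work] -/
theorem three_le_newLabels_of_two_sunflower_three' {P : Finset (Finset α)} {r : α} {K : Finset α}
    (h2 : #(above P r) = 2) (h3 : #(below P r) = 3) (hK : ∀ b ∈ below P r, ∀ b' ∈ below P r, b ≠ b' → b ∩ b' = K) :
    3 ≤ newLabels P r := by
  have hD := card_above_mul_card_below_le P r
  rw [h2, h3] at hD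
  have hc := card_crossMeets_add_card_crossJoins_le P r
  have hL := card_meets_le_one_of_sunflower hK
  obtain ⟨a, a', haa, hA⟩ := card_eq_two.1 h2
  have hJ : #(joins (above P r)) ≤ 1 := by
    apply card_le_one.2
    intro W hW W' hW'
    obtain ⟨x, hx, y, hy, hxy, rfl⟩ := mem_joins_iff.1 hW
    obtain ⟨x', hx', y', hy', hxy', rfl⟩ := mem_joins_iff.1 hW'
    rw [hA, mem_insert, mem_singleton] at hx hy hx' hy'
    rcases hx with rfl | rfl <;> rcases hy with rfl | rfl <;> rcases hx' with rfl | rfl <;> rcases hy' with rfl | rfl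
    all_goals first | exact absurd rfl hxy | exact absurd rfl hxy' | simp [union_comm]
  -- `#X · #Y ≥ 6` forces `#X + #Y ≥ 5`
  have h5 : 5 ≤ #(crossMeets P r) + #(crossJoins P r) := by
    by_contra hlt
    have hx : #(crossMeets P r) ≤ 4 := by omega
    have hy : #(crossJoins P r) ≤ 4 := by omega
    interval_cases (#(crossMeets P r)) <;> interval_cases (#(crossJoins P r)) <;> omega
  omega

end Summit.CriticalPhenomena.PercolationContinuityZ3.Theorems.SahiColouredDaykin
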